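import Summits.QuantumFields.YangMills.Theorems.UnitScaleTiltProp7RieszTauFrobNormT3
import Summits.QuantumFields.YangMills.Theorems.UnitScaleTiltProp7SectET3DeltaPiT3PInv
import Literature.MathematicalPhysics.QuantumFieldTheory.Balaban1983to89.B9Eq3124GaugeModes
import HarnessLib

/-!
# Route `UnitScaleTilt`, crux K1 «MinimiserStabilityRegPr» (stmt-QuantumFields-19200), EX face S44ᴸγ∕S45, row `hPcol` — **P4a: COLUMN∕ROW DUALITY OF OPERATOR
# KERNELS IN THE WEIGHTED `L²` LETTERS** (LOCATE-hPcol 9923ee3f §3): the `ℓ¹` COLUMN SUM of the kernel of a linear map `A` between two weighted `L²` spaces of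
# the SAME constant weight, against a one-point spike, is at most `dim(fibre)` times the `ℓ^∞ → ℓ^∞` ROW bound of its Hilbert adjoint `A†`.

Cell `ym3-torus` (HUMAN RULING D-0037; rung R3 = SU(2) YM₃ on T³ — NOT d = 4, NOT infinite volume, NOT a mass gap, NOT Clay).  Width seat `ym3-torus-px5` (gen 12).
THEOREMS ONLY (0 `def`, 0 `sorry`); `--supports stmt-QuantumFields-19200 --as helper`; count-neutral.

WHY.  The EX row `hPcol` (✓`minimiserStabilityRegPr_of_EXrowsS44LG` :243–252) is an `ℓ¹` COLUMN sum over the fine sites,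
`Σ_x ‖toL2S⁻¹(G′ᴾ(R_S(D*_{U₀}(toL2 (δ_bd ⊗ E)))))(x)‖ ≤ p139·‖E‖`, of the kernel of `A := G′ᴾ ∘ R_S ∘ D*_{U₀}` (bond fields → site fields).  Every estimate the
(L3′b) book produces is a ROW bound (sup over the output point of a sum over sources: V2∕V4∕V5b∕V6, P2).  The two are exchanged by taking adjoints in print's `L²`
scalar product (3.11): the column of `A` at `(bd, E)` is tested against site fields `g` with `‖g(y)‖ ≤ 1`, `⟪g, Aδ⟫ = ⟪A†g, δ⟫`, and `A† = D_{U₀} ∘ R_S ∘ G′ᴾ`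
(`R_S`, `G′ᴾ` symmetric, `(D*)† = D`) is a GRADIENT row — LOCATE-hPcol §3's «hPcol is a gradient row-sum, not a value row».  THIS FILE is the abstract exchange
(§1, any finite index sets, fibre `EuclideanSpace ℂ m`, same constant weight `c` on both sides — the member's sites AND bonds both carry `c₀`) and its reading in
the member's letters `toL2 ∕ toL2S ∕ Pi.single` (§2): **`hPcol` ⟸ a row bound `R` for `(G′ᴾ R_S D*)†`, with `p139 := 4·√2·R`.**
WHAT IS PROVED (ns `Summit.QuantumFields.YangMills.Theorems.Prop7KernelColumnRowDuality`).
* §1 `norm_le_sum_norm_coord` (`‖v‖ ≤ Σ_k ‖v_k‖` in `EuclideanSpace ℂ m`); ★★★ `sum_norm_apply_le_of_adjoint_row`: for `A : WL2(X, c) → WL2(Y, c)` linear, if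
  `‖(A†g)(x)‖ ≤ R·Gb` whenever `‖g(y)‖ ≤ Gb` for all `y`, then for every `δ` supported at one point `x₀`, `Σ_y ‖(Aδ)(y)‖ ≤ card(m)·(R·‖δ(x₀)‖)`.
* §2 ★★ `sum_norm_symm_apply_single_le_of_adjoint_row` — the member edition: `A : BondL2K ℂ 3 (periodsT3 F K) c₀ W₂ →ₗ[ℂ] SiteL2K ℂ 3 (periodsT3 F K) c₀ W₂`, row bound `R` of
  `LinearMap.adjoint A` in the `WL2.equiv … (bondEquiv F K b)` currency of V6 ⟹ `Σ_x ‖toL2S⁻¹(A(toL2(Pi.single bd E)))(x)‖ ≤ 4·√2·R·‖E‖` (`card(Fin 2 × Fin 2) = 4`,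
  `‖frobEquiv v‖ ≤ ‖v‖`, `‖frobEquiv⁻¹E‖ ≤ √2‖E‖` — ✓`Prop7RieszTauFrobNorm`).
* §3 `GprimeP_isSymmetric` (`0 ≤ a`; lit ✓`greenK_isSymmetric` + ✓`laplacePrimeA_isSymmetric` + ✓`kerDProj_isSymmetric`), ★ `adjoint_GprimeP_RS_DstarL2`
  (`(G′ᴾ ∘ R_S ∘ D*)† = D ∘ R_S ∘ G′ᴾ`, ✓`RS_isSymmetric`, ✓`adjoint_DL2`), and ★★★ `sum_norm_GprimeP_RS_DstarL2_single_le_of_gradient_row` — THE ROW `hPcol` BY TEXT from ONE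
  letter: a row bound `R` of the GRADIENT operator `D_{U₀} R_S G′ᴾ` (`‖(D(R_S(G′ᴾ g)))(p)‖_{W₂} ≤ R·sup_y‖g(y)‖_{W₂}`) ⟹ `Σ_x ‖toL2S⁻¹(G′ᴾ(R_S(D*(toL2(δ_bd ⊗ E)))))(x)‖ ≤ 4√2·R·‖E‖`.
HYP-SAT (★★OWNER RULING №42): §1–§2 are statements about an ARBITRARY linear map `A` and an arbitrary row letter `R` (pure finite-dimensional duality; the
phases `g(y) := (v_y)_k ∕ |(v_y)_k| · e_k` are constructed inside the proof); at the use `A := GprimeP ∘ RS ∘ DstarL2` the row letter is the ROW-SUMMED GRADIENT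
row of `D_{U₀} R_S G′ᴾ` (P3∕V6-general class, behind (G1-3b)); nothing eventual, conclusions non-vacuous.
HONEST SCOPE.  Linear algebra; nothing of `hPcol`, P3, the ten EX rows, `hT`, `hGF`, EX `stub_existenceMinimalOrbit` or the crux is proved here; the Yang–Mills
mass gap is NOT proved.

References: T. Bałaban, CMP **99** (1985) 389–434 [Balaban1985BackgroundPropagators] ((3.11) p.392 — the `L²` scalar products; Thm 3.1 (3.42) p.397 — kernel
bounds stated columnwise∕rowwise); CMP **102** (1985) 277–309 [Balaban1985Variational] ((139) p.299 — the operator whose `ℓ¹` column is `hPcol`).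
-/

set_option autoImplicit false

noncomputable section

open scoped BigOperators InnerProductSpace ComplexConjugate Matrix.Norms.L2Operator

namespace Summit.QuantumFields.YangMills.Theorems.Prop7KernelColumnRowDuality

open Literature.MathematicalPhysics.QuantumFieldTheory.Balaban1983to89
open Literature.MathematicalPhysics.QuantumFieldTheory.Balaban1983to89.T3ContinuumYM3Torus
open B9Eq311L2Pairing (WL2)
open B11Eq103H1Complex (SiteL2K BondL2K)
open Summit.QuantumFields.YangMills.Theorems.Prop7SectET3Transport (periodsT3 siteEquiv bondEquiv)
open Summit.QuantumFields.YangMills.Theorems.Prop7SectET3HilbertLetters (W₂ frobEquiv toL2 toL2S toL2_apply toL2S_symm_apply)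
open Summit.QuantumFields.YangMills.Theorems.Prop7RieszTauFrobNorm (norm_frobEquiv_le norm_frobEquiv_symm_le)
open Summit.QuantumFields.YangMills.Theorems.Prop7SectET3HilbertLetters (DL2 DstarL2 adjoint_DL2)
open Summit.QuantumFields.YangMills.Theorems.Prop7SectET3GaugeProjector (RS RS_isSymmetric)
open Summit.QuantumFields.YangMills.Theorems.Prop7SectET3DeltaPi (laplacePrimeA)
open Summit.QuantumFields.YangMills.Theorems.Prop7SectET3DeltaPiPInv (GprimeP GprimeP_eq kerDProj kerDProj_isSymmetric laplacePrimeA_isSymmetric laplacePrimeA_add_kerDProj_pos)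
open B11Eq103H1Complex (greenK)
open B9Eq3124GaugeModes (greenK_isSymmetric)

/-! ## §1 The abstract exchange: `ℓ¹` column of `A` ≤ `dim` × `ℓ^∞` row of `A†` -/

section Abstract

variable {X Y m : Type*} [Fintype X] [Fintype Y] [Fintype m] [DecidableEq m] {c : ℝ} [Fact (0 < c)]

omit [DecidableEq m] in
/-- `‖v‖ ≤ Σ_k ‖v_k‖` in `EuclideanSpace ℂ m` (`ℓ² ≤ ℓ¹`). [folklore] -/
theorem norm_le_sum_norm_coord (v : EuclideanSpace ℂ m) : ‖v‖ ≤ ∑ k, ‖v k‖ := by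
  have h0 : 0 ≤ ∑ k, ‖v k‖ := Finset.sum_nonneg fun k _ => norm_nonneg _
  have h1 : ∑ k, ‖v k‖ ^ 2 ≤ (∑ k, ‖v k‖) ^ 2 := by
    rw [sq (∑ k, ‖v k‖), Finset.sum_mul]
    exact Finset.sum_le_sum fun k _ => by
      rw [sq]
      exact mul_le_mul_of_nonneg_left (Finset.single_le_sum (fun j _ => norm_nonneg (v j)) (Finset.mem_univ k)) (norm_nonneg _)
  rw [EuclideanSpace.norm_eq]
  calc Real.sqrt (∑ k, ‖v k‖ ^ 2) ≤ Real.sqrt ((∑ k, ‖v k‖) ^ 2) := Real.sqrt_le_sqrt h1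
    _ = ∑ k, ‖v k‖ := Real.sqrt_sq h0

/-- ★★★ **COLUMN∕ROW DUALITY.**  Let `A : WL2(X, c; ℂ^m) → WL2(Y, c; ℂ^m)` be linear between weighted `L²` spaces with the SAME constant weight `c > 0`, and suppose its
Hilbert adjoint has the `ℓ^∞ → ℓ^∞` row bound `R`: `‖(A†g)(x)‖ ≤ R·Gb` whenever `‖g(y)‖ ≤ Gb` for all `y`.  Then for every `δ` supported at a single point `x₀`, the
`ℓ¹` column sum obeys `Σ_y ‖(Aδ)(y)‖ ≤ card(m)·R·‖δ(x₀)‖`.  Proof: per coordinate `k`, test against `g(y) := phase((Aδ)(y)_k)·e_k` (`‖g(y)‖ ≤ 1`):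
`c·Σ_y |(Aδ)(y)_k| = ⟪g, Aδ⟫ = ⟪A†g, δ⟫ = c·⟪(A†g)(x₀), δ(x₀)⟫ ≤ c·R·‖δ(x₀)‖`; then `‖v‖ ≤ Σ_k |v_k|`.
[cite: Balaban1985BackgroundPropagators, (3.11) p.392, Thm 3.1 (3.42) p.397] -/
theorem sum_norm_apply_le_of_adjoint_row
    (A : WL2 ℂ (fun _ : X => c) (EuclideanSpace ℂ m) →ₗ[ℂ] WL2 ℂ (fun _ : Y => c) (EuclideanSpace ℂ m)) {R : ℝ}
    (hrow : ∀ (g : WL2 ℂ (fun _ : Y => c) (EuclideanSpace ℂ m)) (Gb : ℝ),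
      (∀ y, ‖WL2.equiv ℂ (fun _ : Y => c) (EuclideanSpace ℂ m) g y‖ ≤ Gb) →
        ∀ x, ‖WL2.equiv ℂ (fun _ : X => c) (EuclideanSpace ℂ m) (LinearMap.adjoint A g) x‖ ≤ R * Gb)
    (δ : WL2 ℂ (fun _ : X => c) (EuclideanSpace ℂ m)) (x₀ : X)
    (hδ : ∀ x, x ≠ x₀ → WL2.equiv ℂ (fun _ : X => c) (EuclideanSpace ℂ m) δ x = 0) :
    ∑ y, ‖WL2.equiv ℂ (fun _ : Y => c) (EuclideanSpace ℂ m) (A δ) y‖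
      ≤ Fintype.card m * (R * ‖WL2.equiv ℂ (fun _ : X => c) (EuclideanSpace ℂ m) δ x₀‖) := by
  classical
  have hc : 0 < c := Fact.out
  -- per coordinate `k`
  have hk : ∀ k : m, ∑ y, ‖WL2.equiv ℂ (fun _ : Y => c) (EuclideanSpace ℂ m) (A δ) y k‖
      ≤ R * ‖WL2.equiv ℂ (fun _ : X => c) (EuclideanSpace ℂ m) δ x₀‖ := by
    intro k
    set v := WL2.equiv ℂ (fun _ : Y => c) (EuclideanSpace ℂ m) (A δ) with hv
    -- the phases
    have hs1 : ∀ y, ‖v y k / ((‖v y k‖ : ℝ) : ℂ)‖ ≤ 1 := fun y => by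
      rw [norm_div, Complex.norm_real, Real.norm_of_nonneg (norm_nonneg _)]
      exact div_self_le_one _
    have hs2 : ∀ y, (starRingEnd ℂ) (v y k / ((‖v y k‖ : ℝ) : ℂ)) * v y k = ((‖v y k‖ : ℝ) : ℂ) := fun y => by
      by_cases h0 : v y k = 0
      · simp [h0]
      · have hr : ((‖v y k‖ : ℝ) : ℂ) ≠ 0 := by exact_mod_cast norm_ne_zero_iff.mpr h0
        rw [map_div₀, Complex.conj_ofReal, div_mul_eq_mul_div, Complex.conj_mul', sq, mul_div_assoc, div_self hr, mul_one]
    -- the test vector `g(y) := phase · e_k`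
    let g : WL2 ℂ (fun _ : Y => c) (EuclideanSpace ℂ m) :=
      (WL2.equiv ℂ (fun _ : Y => c) (EuclideanSpace ℂ m)).symm (fun y => EuclideanSpace.single k (v y k / ((‖v y k‖ : ℝ) : ℂ)))
    have hg : ∀ y, WL2.equiv ℂ (fun _ : Y => c) (EuclideanSpace ℂ m) g y = EuclideanSpace.single k (v y k / ((‖v y k‖ : ℝ) : ℂ)) := fun _ => rfl
    have hg1 : ∀ y, ‖WL2.equiv ℂ (fun _ : Y => c) (EuclideanSpace ℂ m) g y‖ ≤ 1 := fun y => by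
      rw [hg, PiLp.norm_single]; exact hs1 y
    -- `⟪g, Aδ⟫ = c · Σ_y |v_y k|`
    have hinner : ⟪g, A δ⟫_ℂ = ((c * ∑ y, ‖v y k‖ : ℝ) : ℂ) := by
      rw [WL2.inner_def, Complex.ofReal_mul, Complex.ofReal_sum, Finset.mul_sum]
      refine Finset.sum_congr rfl fun y _ => ?_
      rw [hg, EuclideanSpace.inner_single_left, ← hv, hs2 y]
      rfl
    -- `⟪g, Aδ⟫ = ⟪A†g, δ⟫ = c · ⟪(A†g)(x₀), δ(x₀)⟫`
    have hadj : ⟪g, A δ⟫_ℂ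
        = ((c : ℝ) : ℂ) * ⟪WL2.equiv ℂ (fun _ : X => c) (EuclideanSpace ℂ m) (LinearMap.adjoint A g) x₀,
            WL2.equiv ℂ (fun _ : X => c) (EuclideanSpace ℂ m) δ x₀⟫_ℂ := by
      rw [← LinearMap.adjoint_inner_left, WL2.inner_def, Finset.sum_eq_single x₀]
      · rfl
      · intro x _ hx
        rw [hδ x hx, inner_zero_right, mul_zero]
      · intro h
        exact absurd (Finset.mem_univ x₀) h
    have h1 : ‖⟪g, A δ⟫_ℂ‖ ≤ c * (R * ‖WL2.equiv ℂ (fun _ : X => c) (EuclideanSpace ℂ m) δ x₀‖) := by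
      rw [hadj, norm_mul, Complex.norm_real, Real.norm_of_nonneg hc.le]
      refine mul_le_mul_of_nonneg_left ((norm_inner_le_norm _ _).trans ?_) hc.le
      exact mul_le_mul_of_nonneg_right (by simpa only [mul_one] using hrow g 1 hg1 x₀) (norm_nonneg _)
    have h2 : ‖⟪g, A δ⟫_ℂ‖ = c * ∑ y, ‖v y k‖ := by
      rw [hinner, Complex.norm_real, Real.norm_of_nonneg (mul_nonneg hc.le (Finset.sum_nonneg fun y _ => norm_nonneg _))]
    rw [h2] at h1
    exact le_of_mul_le_mul_left h1 hc
  -- sum over the coordinates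
  calc ∑ y, ‖WL2.equiv ℂ (fun _ : Y => c) (EuclideanSpace ℂ m) (A δ) y‖
      ≤ ∑ y, ∑ k, ‖WL2.equiv ℂ (fun _ : Y => c) (EuclideanSpace ℂ m) (A δ) y k‖ :=
        Finset.sum_le_sum fun y _ => norm_le_sum_norm_coord _
    _ = ∑ k, ∑ y, ‖WL2.equiv ℂ (fun _ : Y => c) (EuclideanSpace ℂ m) (A δ) y k‖ := Finset.sum_comm
    _ ≤ ∑ _k : m, R * ‖WL2.equiv ℂ (fun _ : X => c) (EuclideanSpace ℂ m) δ x₀‖ := Finset.sum_le_sum fun k _ => hk k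
    _ = Fintype.card m * (R * ‖WL2.equiv ℂ (fun _ : X => c) (EuclideanSpace ℂ m) δ x₀‖) := by
        rw [Finset.sum_const, Finset.card_univ, nsmul_eq_mul]

omit [DecidableEq m] in
/-- The row letter forces `0 ≤ R` (test `g = 0`, `Gb = 1`) as soon as `X` is inhabited. [folklore] -/
theorem adjoint_row_nonneg
    (A : WL2 ℂ (fun _ : X => c) (EuclideanSpace ℂ m) →ₗ[ℂ] WL2 ℂ (fun _ : Y => c) (EuclideanSpace ℂ m)) {R : ℝ}
    (hrow : ∀ (g : WL2 ℂ (fun _ : Y => c) (EuclideanSpace ℂ m)) (Gb : ℝ),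
      (∀ y, ‖WL2.equiv ℂ (fun _ : Y => c) (EuclideanSpace ℂ m) g y‖ ≤ Gb) →
        ∀ x, ‖WL2.equiv ℂ (fun _ : X => c) (EuclideanSpace ℂ m) (LinearMap.adjoint A g) x‖ ≤ R * Gb)
    (x₀ : X) : 0 ≤ R := by
  have h := hrow 0 1 (fun y => by rw [show WL2.equiv ℂ (fun _ : Y => c) (EuclideanSpace ℂ m) 0 y = 0 from rfl, norm_zero]; exact zero_le_one) x₀
  rw [map_zero, show WL2.equiv ℂ (fun _ : X => c) (EuclideanSpace ℂ m) 0 x₀ = 0 from rfl, norm_zero, mul_one] at h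
  exact h

end Abstract

/-! ## §2 The member edition: `hPcol`'s column sum from a row bound of the adjoint -/

variable (F : T3Family) {K : ℕ} (c₀ : ℝ) [Fact (0 < c₀)]

/-- ★★ **`hPcol`'S SHAPE FROM A ROW BOUND OF THE ADJOINT.**  For ANY linear `A` from the member's bond `L²` space to its site `L²` space (both weight `c₀`, fibre `W₂`):
if `LinearMap.adjoint A` has the row bound `R` in V6's pointwise currency — `‖(A†g)(bondEquiv b)‖_{W₂} ≤ R·Gb` whenever `‖g(y)‖_{W₂} ≤ Gb` for all lit-sites `y` — then
for every bond `bd` and matrix `E`, `Σ_{x : Site (F.P K) 0} ‖toL2S⁻¹(A(toL2(Pi.single bd E)))(x)‖ ≤ 4·√2·R·‖E‖` (operator norms on `M₂(ℂ)`; `4 = dim W₂`, `√2` = Frobenius vs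
operator norm).  At `A := GprimeP U₀ ∘ RS U₀ ∘ DstarL2 U₀` this is the EX row `hPcol` with `p139 := 4√2·R`. [cite: Balaban1985BackgroundPropagators, (3.11) p.392, Thm 3.1 (3.42) p.397;
Balaban1985Variational, (139) p.299] -/
theorem sum_norm_symm_apply_single_le_of_adjoint_row
    (A : BondL2K ℂ 3 (periodsT3 F K) c₀ W₂ →ₗ[ℂ] SiteL2K ℂ 3 (periodsT3 F K) c₀ W₂) {R : ℝ}
    (hrow : ∀ (g : SiteL2K ℂ 3 (periodsT3 F K) c₀ W₂) (Gb : ℝ),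
      (∀ y, ‖WL2.equiv ℂ _ W₂ g y‖ ≤ Gb) → ∀ p, ‖WL2.equiv ℂ _ W₂ (LinearMap.adjoint A g) p‖ ≤ R * Gb)
    (bd : PBond (F.P K) 0) (E : Matrix (Fin 2) (Fin 2) ℂ) :
    ∑ x : Site (F.P K) 0, ‖(toL2S F K c₀).symm (A (toL2 F K c₀ (Pi.single bd E))) x‖ ≤ 4 * Real.sqrt 2 * R * ‖E‖ := by
  have hδ : ∀ p, p ≠ bondEquiv F K bd → WL2.equiv ℂ _ W₂ (toL2 F K c₀ (Pi.single bd E)) p = 0 := by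
    intro p hp
    have hne : (bondEquiv F K).symm p ≠ bd := fun h => hp ((Equiv.symm_apply_eq _).mp h)
    rw [toL2_apply, Pi.single_eq_of_ne hne, map_zero]
  have hR : 0 ≤ R := adjoint_row_nonneg A hrow (bondEquiv F K bd)
  have hmain := sum_norm_apply_le_of_adjoint_row A hrow (toL2 F K c₀ (Pi.single bd E)) (bondEquiv F K bd) hδ
  rw [toL2_apply, Equiv.symm_apply_apply, Pi.single_eq_same] at hmain
  have hcard : (Fintype.card (Fin 2 × Fin 2) : ℝ) = 4 := by norm_num [Fintype.card_prod, Fintype.card_fin]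
  rw [hcard] at hmain
  calc ∑ x : Site (F.P K) 0, ‖(toL2S F K c₀).symm (A (toL2 F K c₀ (Pi.single bd E))) x‖
      ≤ ∑ x : Site (F.P K) 0, ‖WL2.equiv ℂ _ W₂ (A (toL2 F K c₀ (Pi.single bd E))) (siteEquiv F K x)‖ :=
        Finset.sum_le_sum fun x _ => by rw [toL2S_symm_apply]; exact norm_frobEquiv_le _
    _ = ∑ y, ‖WL2.equiv ℂ _ W₂ (A (toL2 F K c₀ (Pi.single bd E))) y‖ :=
        (siteEquiv F K).sum_comp (fun y => ‖WL2.equiv ℂ _ W₂ (A (toL2 F K c₀ (Pi.single bd E))) y‖)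
    _ ≤ 4 * (R * ‖(frobEquiv.symm E : W₂)‖) := hmain
    _ ≤ 4 * (R * (Real.sqrt 2 * ‖E‖)) := by
        gcongr
        exact norm_frobEquiv_symm_le E
    _ = 4 * Real.sqrt 2 * R * ‖E‖ := by ring

/-! ## §3 `hPcol` by text from ONE gradient row letter -/

section Pcol

variable {n : ℕ} (h : n ≤ K) (cB a : ℝ) [Fact (0 < cB)]

/-- `G′ᴾ = (Δ′_a + P₀)⁻¹ − P₀` is symmetric for `0 ≤ a` (inverse of a symmetric positive-definite operator, minus an orthogonal projection).
[cite: Balaban1985BackgroundPropagators, (3.24)–(3.25) p.394] -/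
theorem GprimeP_isSymmetric (ha : 0 ≤ a) (U₀ : GaugeField (F.P K) 0 (Matrix.specialUnitaryGroup (Fin 2) ℂ)) :
    (GprimeP F n K h c₀ cB a U₀).IsSymmetric := by
  have hP : (kerDProj F n K c₀ U₀).IsSymmetric := kerDProj_isSymmetric U₀
  have hT : (laplacePrimeA F n K h c₀ cB a U₀ + kerDProj F n K c₀ U₀).IsSymmetric := (laplacePrimeA_isSymmetric U₀).add hP
  have hG : (greenK (laplacePrimeA F n K h c₀ cB a U₀ + kerDProj F n K c₀ U₀) (laplacePrimeA_add_kerDProj_pos ha U₀)).IsSymmetric :=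
    greenK_isSymmetric _ hT
  rw [GprimeP_eq ha]
  exact hG.sub hP

/-- ★ `(G′ᴾ ∘ R_S ∘ D*_{U₀})† = D_{U₀} ∘ R_S ∘ G′ᴾ` (`R_S`, `G′ᴾ` symmetric; `D*` is the adjoint of `D`). [cite: Balaban1985BackgroundPropagators, (3.8) p.392, (3.21)–(3.25) p.394] -/
theorem adjoint_GprimeP_RS_DstarL2 (ha : 0 ≤ a) (U₀ : GaugeField (F.P K) 0 (Matrix.specialUnitaryGroup (Fin 2) ℂ)) :
    LinearMap.adjoint (GprimeP F n K h c₀ cB a U₀ ∘ₗ RS F n K h c₀ cB U₀ ∘ₗ DstarL2 F n K c₀ U₀)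
      = DL2 F n K c₀ U₀ ∘ₗ RS F n K h c₀ cB U₀ ∘ₗ GprimeP F n K h c₀ cB a U₀ := by
  have hG : LinearMap.adjoint (GprimeP F n K h c₀ cB a U₀) = GprimeP F n K h c₀ cB a U₀ :=
    LinearMap.isSelfAdjoint_iff'.mp ((LinearMap.isSymmetric_iff_isSelfAdjoint _).mp (GprimeP_isSymmetric F c₀ h cB a ha U₀))
  have hR : LinearMap.adjoint (RS F n K h c₀ cB U₀) = RS F n K h c₀ cB U₀ :=
    LinearMap.isSelfAdjoint_iff'.mp ((LinearMap.isSymmetric_iff_isSelfAdjoint _).mp (RS_isSymmetric U₀))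
  have hD : LinearMap.adjoint (DstarL2 F n K c₀ U₀) = DL2 F n K c₀ U₀ := by
    rw [← adjoint_DL2, LinearMap.adjoint_adjoint]
  rw [LinearMap.adjoint_comp, LinearMap.adjoint_comp, hG, hR, hD, LinearMap.comp_assoc]

/-- ★★★ **THE EX ROW `hPcol` BY TEXT FROM ONE GRADIENT ROW LETTER.**  If the gradient operator `D_{U₀} ∘ R_S ∘ G′ᴾ` has the `ℓ^∞ → ℓ^∞` row bound `R` in V6's pointwise
currency — `‖(D(R_S(G′ᴾ g)))(p)‖_{W₂} ≤ R·Gb` whenever `‖g(y)‖_{W₂} ≤ Gb` for all lit-sites `y` — then for every bond `bd` and matrix `E`,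
`Σ_{x : Site (F.P K) 0} ‖toL2S⁻¹(G′ᴾ(R_S(D*_{U₀}(toL2(Pi.single bd E)))))(x)‖ ≤ 4·√2·R·‖E‖` — the display of `hPcol` (✓`minimiserStabilityRegPr_of_EXrowsS44LG` :243–252) with
`p139 := 4√2·R`.  (The letter is the ROW-SUMMED GRADIENT ROW of print's (3.42) for `D G′ R` — LOCATE-hPcol §3; under the Lift antecedent P1 ✓`GprimeP_RS_eq` rewrites
`R_S G′ᴾ = R_S G (1 − P₀)` with the LOD `G`.) [cite: Balaban1985BackgroundPropagators, Thm 3.1 (3.42) p.397; Balaban1985Variational, (139) p.299] -/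
theorem sum_norm_GprimeP_RS_DstarL2_single_le_of_gradient_row (ha : 0 ≤ a) (U₀ : GaugeField (F.P K) 0 (Matrix.specialUnitaryGroup (Fin 2) ℂ)) {R : ℝ}
    (hrow : ∀ (g : SiteL2K ℂ 3 (periodsT3 F K) c₀ W₂) (Gb : ℝ), (∀ y, ‖WL2.equiv ℂ _ W₂ g y‖ ≤ Gb) →
      ∀ p, ‖WL2.equiv ℂ _ W₂ (DL2 F n K c₀ U₀ (RS F n K h c₀ cB U₀ (GprimeP F n K h c₀ cB a U₀ g))) p‖ ≤ R * Gb)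
    (bd : PBond (F.P K) 0) (E : Matrix (Fin 2) (Fin 2) ℂ) :
    ∑ x : Site (F.P K) 0, ‖(toL2S F K c₀).symm (GprimeP F n K h c₀ cB a U₀ (RS F n K h c₀ cB U₀ (DstarL2 F n K c₀ U₀ (toL2 F K c₀ (Pi.single bd E))))) x‖
      ≤ 4 * Real.sqrt 2 * R * ‖E‖ := by
  have h3 := sum_norm_symm_apply_single_le_of_adjoint_row F c₀ (GprimeP F n K h c₀ cB a U₀ ∘ₗ RS F n K h c₀ cB U₀ ∘ₗ DstarL2 F n K c₀ U₀) (R := R)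
    (fun g Gb hg p => by rw [adjoint_GprimeP_RS_DstarL2 F c₀ h cB a ha U₀]; exact hrow g Gb hg p) bd E
  simpa only [LinearMap.comp_apply] using h3

end Pcol

end Summit.QuantumFields.YangMills.Theorems.Prop7KernelColumnRowDuality

end
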